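import Mathlib

/-!
# `Balaban1983to89.B11SchwarzRemainder` — [Balaban1985Variational] p. 286 (55)–(56), p. 289 (the 𝔇₂ remark), p. 290
(78)/(80): the Schwarz-lemma step «at the chart radius» that turns the printed quadratic bound (55) into a CUBIC bound on
D₃ = D − D^{(2)} and the printed linear bound (73) into the ε₃²-bound on 𝔇₂ — a step the paper uses and does not print

CITATION HEADER (lean-in-tree rule 2026-08-18).  Source: T. Bałaban, *The variational problem and background fields in
renormalization group method for lattice gauge theories*, Commun. Math. Phys. **102**, 277–309 (1985),
doi:10.1007/bf01229381 (cell paper B11 = [15] of B13; held `paper:balaban1985-cmp102-variational-background`; journal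
page = PDF page + 276; quotations below read from the page renders pp. 286, 289, 290 [PDF 10, 13, 14],
`b2b-balaban-ref1/pages/1985-cmp102-variational-background/…-p010,p013,p014-x2.png`, READ AS IMAGES).  Reference of the
paper used here: [4] = [Balaban1985Averaging] = T. Bałaban, *Averaging operations for lattice gauge theories*, Commun.
Math. Phys. **98**, 17–51 (1985) (cell paper B7; journal page = PDF page + 16; Proposition 4 (134)–(136) pp. 38–39
[PDF 22–23], renders `…/1985-cmp98-averaging/…-p022,p023-x2.png` read as images; sibling module `…B7`,
`B7.Prop4Printed`).  This module imports Mathlib only and modifies nothing in `…B11`, `…B7`, `…B13`; it is one-variable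
complex analysis (Mathlib's Schwarz lemma `Complex.norm_dslope_le_div_of_mapsTo_ball` and the divided slopes `dslope`)
plus real-number bookkeeping over named constants.  Cell records: `HOME/GAPS.md` rows G-adv2-29 (ii) (B13 p. 10 ← B11
(80): no printed cubic bound on D₃) and G-adv9-52 (B11 p. 289: 𝔇₂ «(73) with ε₃² instead of ε₃» only at the maximal
chart radius); this module is what both rows name under «what would certify».

THE PRINTED TEXT (p. 286 [PDF 10], verbatim).  *"From Eq. (49) we obtain
|D(A′)| = |C_j(L^jηA′ − L^jηHD(A′))| ≦ C₂(L^jη|A′| + B₀|D(A′)|)² ≦ 4C₂|A′|²_{(−1)}. (55)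
This implies that a power series expansion of D(A′) begins with second order terms. We can find this expression from
Eq. (49) and the expansion (136) [4] of the function C_j:
C_j(L^jηA′ − L^jηHD(A′)) = Σ_{n=2}^∞ C_j^{(n)}(L^jηA′ − L^jηH Σ_{m=2}^∞ D^{(m)}(A′)) = Σ_{n=2}^∞ D^{(n)}(A′), (56)
where C_j^{(n)}, D^{(n)} are homogeneous polynomials of n^{th} order. From Eq. (56) a sequence of recursive equations for
D^{(n)} follows. It can be solved easily. For example we have on Λ_j
D^{(2)}(A′) = C_j^{(2)}(L^jηA′), D^{(3)}(A′) = C_j^{(3)}(L^jηA′) − 2C_j^{(2)}(L^jηA′, L^jηHC^{(2)}(A′)), and so on."*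
— and earlier on the same page: *"This solution is a limit of uniformly convergent sequence of successive approximations
and it is an analytic function of A′."* (D analytic for L^jη|A′| < ε₃ on Ω_j, i.e. |A′|_{(−1)} < ε₃.)
p. 290 [PDF 14], verbatim: *"The expression ⟨HD(A′), J⟩ may be decomposed into terms of second and higher orders.
Taking into account that the second order term D^{(2)}(A′) in the expansion of D(A′) is equal to C^{(2)}(A′)
= C_j^{(2)}(L^jηA′) on Λ_j, we have ⟨HD(A′), J⟩ = ⟨HC^{(2)}(A′), J⟩ + ⟨HD₃(A′), J⟩. (78)"* and *"V(A′) = −⟨HD₃(A′), J⟩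
− ⟨A′, Δ_πHD(A′)⟩ + ½⟨HD(A′), Δ_πHD(A′)⟩ + V₀(A′ − HD(A′)). (80)  It is analytic in A′ for A′ with values in the
complexified algebra and satisfying (77)."* — so D₃ := D − D^{(2)} = D − C^{(2)}, the part of D of order ≥ 3.
p. 289 [PDF 13], verbatim: *"|𝔇(A′; c, b)| ≦ O(1)C₃ε₃(L^jη)^{−d+1}e^{−(1/2)δ₀d(c₋,y)}, b ∈ B^j(y), y ∈ Λ_j. (73)"*;
*"Proposition 3. The transformation (47) … is defined and analytic for A′ satisfying (43) with ε₃ sufficiently small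
(e.g. 18C₂B₀dc₁(½)ε₃ ≦ 1, 2ε₃ ≦ c₄). … The function D(A′) satisfies the bound (55) and its functional derivative
satisfies the bound (73)."*; and the remark: *"The operator 𝔇(A′) is an analytic function in A′, and its expansion
begins with a linear term in A′, coming from the differentiation of D^{(2)}(A′) = C^{(2)}(A′). If we subtract these
terms from 𝔇(A′), then we get an operator 𝔇₂(A′) for which we have the bound (73) with ε₃² instead of ε₃."*
[4] p. 38 [PDF 22], verbatim: *"Proposition 4. There exist constants C₂, c₄ such that for α₀, α₁ ≦ c₄ the function
Q_k(U₀, ηA, c) = (1/i) log(Ū₁^k)_c, c ⊂ Ω^{(k)}, is an analytic function of the variables A_b, b ⊂ B^k(c₋)∪B^k(c₊).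
Further we have Q_k(U₀, ηA) = Q_k(U₀)A + C_k(U₀, A), (134) and |C_k(U₀, A)| ≦ C₂|A|² < C₂α₁². (135)"*; p. 39
[PDF 23]: *"The function C_k can be decomposed further into a sum of homogeneous polynomials,
C_k(U₀, A) = C_k^{(2)}(U₀, A) + C_k^{(3)}(U₀, A) + … . (136)"*, and the slice calculus the series uses for functional
derivatives: *"dF(A, δA) = (d/dt)F(A + tδA)|_{t=0} (137)"*.

WHAT THE PAPER USES AND DOES NOT PRINT (cell GAPS G-adv2-29 (ii), G-adv9-52).  (a) B13 p. 10 bounds the term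
−⟨HD₃(A′), J⟩ of (80) citing «(33), (37), (55), (57), (58) [15]»; (55) is QUADRATIC and nothing on pp. 286–290 bounds
D₃ = D − D^{(2)} CUBICALLY ((56) gives the series, no bound).  (b) The remark on p. 289 asserts for 𝔇₂ «the bound (73)
with ε₃² instead of ε₃»; (73) is LINEAR in the chart parameter ε₃, and subtracting the linear term on the ε₃-ball gives
back O(1)C₃ε₃, not ε₃² (`tightness_witness`): the ε₃² is obtained only on the MAXIMAL chart |A′|_{(−1)} < a₃ :=
min{(18C₂B₀dc₁(½))⁻¹, ½c₄} of Proposition 3, with the constant O(1)·2/a₃.  Both are one application of the SAME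
one-variable fact along complex slices t ↦ F(tÂ) (the series' own device, [4] (137)): an analytic f on the disc |t| < r
with ‖f‖ ≤ M and f = O(tⁿ) at 0 satisfies ‖f(t)‖ ≤ M(|t|/r)ⁿ (`norm_le_of_orderGe`, the order-n Schwarz lemma), its
leading coefficient aₙ = lim t⁻ⁿf(t) has ‖aₙ‖ ≤ M/rⁿ (`norm_leadCoeff_le`, `tendsto_leadCoeff`), and the next remainder
obeys ‖f(t) − tⁿaₙ‖ ≤ (M + A rⁿ)(|t|/r)ⁿ⁺¹ whenever ‖aₙ‖ ≤ A (`norm_sub_leadCoeff_le`).  THE TWO READINGS, with the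
printed constants as real parameters: (D₃) if ‖f(t)‖ ≤ 4C₂|t|² on |t| < ε₃ — (55) along the slice t ↦ D(tÂ′; c),
|Â′|_{(−1)} = 1 — then ‖a₂‖ ≤ 4C₂ and ‖f(t) − t²a₂‖ ≤ 8C₂ε₃⁻¹|t|³ (`reading_D3`; G-adv2-29's constant), and
≤ 5C₂ε₃⁻¹|t|³ if ‖a₂‖ ≤ C₂ is fed in from (135) (`reading_D3_with135`, `reading_C2_of_135`); (𝔇₂) if ‖f(t)‖ ≤ K|t| on
|t| < a — the family (73)_{ε₃ ≤ a₃} along the slice t ↦ 𝔇(tÂ; c, b), K = O(1)C₃(L^jη)^{−d+1}e^{−(1/2)δ₀d(c₋,y)},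
a = a₃ — then ‖f(t) − t a₁‖ ≤ 2K a⁻¹|t|² ≤ 2K a₃⁻¹ε₃² for |t| < ε₃ ≤ a₃ (`reading_frakD2`), while at a = ε₃ the
function f(t) = (K/ε₃)t² meets every hypothesis and has remainder exactly K ε₃⁻¹|t|² → Kε₃ (`tightness_witness`).

WHAT IS NOT CLAIMED.  Nothing here constructs D, D^{(n)}, 𝔇, C_j or the norms |·|_{(−1)}; the identification of the
paper's D^{(2)}(Â′) (defined through (56)) with the t²-coefficient `leadCoeff f 2` of the slice function is supplied
to the consumer as the two hooks `tendsto_leadCoeff` (a₂ = lim_{t→0} t⁻²f(t)) and `leadCoeff_eq_of_orderGe_sub` (any a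
with f − t²a = O(t³) IS a₂), whose hypothesis «D − D^{(2)} = O(t³) along slices» is the qualitative content of (56)
(homogeneous terms of order ≥ 3 of a convergent expansion).  The passage from the slice bounds to the sup-norm statements
|D₃(A′)| ≤ 8C₂ε₃⁻¹|A′|³_{(−1)}, |𝔇₂(A′; c, b)| ≤ 2·O(1)(C₃/a₃)ε₃²(L^jη)^{−d+1}e^{−(1/2)δ₀d(c₋,y)} is componentwise
(one slice per component c resp. kernel entry (c, b), t = |A′|_{(−1)} real, `reading_D3_real`) and involves no further
estimate.  The programme-level question these constants feed (the provenance of «C₃ an absolute constant» in B13 (1.39)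
and of C₄ in B11 Prop. 4: they contain ε₃⁻¹ ≥ 18C₂B₀ resp. a₃⁻¹, both (d, L)-constants) is recorded in the cell
GAPS rows, not decided here.  value = kernel certificate of a located unprinted step with its constants, NOT summit
progress.
-/

open Metric Set Filter Topology Asymptotics

namespace Literature.MathematicalPhysics.QuantumFieldTheory.Balaban1983to89.B11SchwarzRemainder

variable {E : Type*} [NormedAddCommGroup E]

/-! ## §1  Vanishing order at 0 and iterated divided slopes (Mathlib `dslope`) -/

/-- «f begins with terms of order n at t = 0» ([Balaban1985Variational] p. 286: *"a power series expansion of D(A′)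
begins with second order terms"*; p. 289: *"its expansion begins with a linear term"*), typed as an eventual bound
‖f(t)‖ ≤ C|t|ⁿ on the punctured neighbourhood of 0 — equivalently `f =O[𝓝[≠] 0] (t ↦ tⁿ)` (`orderGe_iff_isBigO`).
[folklore] -/
def OrderGe (f : ℂ → E) (n : ℕ) : Prop :=
  ∃ C : ℝ, ∀ᶠ t in 𝓝[≠] (0 : ℂ), ‖f t‖ ≤ C * ‖t‖ ^ n

/-- `OrderGe f n` is Mathlib's `f =O[𝓝[≠] 0] (fun t ↦ t ^ n)`. [folklore] -/
theorem orderGe_iff_isBigO {f : ℂ → E} {n : ℕ} :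
    OrderGe f n ↔ f =O[𝓝[≠] (0 : ℂ)] (fun t : ℂ => t ^ n) := by
  simp only [OrderGe, isBigO_iff, norm_pow]

/-- A bound ‖f(t)‖ ≤ C|t|ⁿ on a disc gives order n (the form in which (55) and (135) are printed). [folklore] -/
theorem OrderGe.of_bound_on_ball {f : ℂ → E} {n : ℕ} {C r : ℝ} (hr : 0 < r)
    (h : ∀ t ∈ ball (0 : ℂ) r, ‖f t‖ ≤ C * ‖t‖ ^ n) : OrderGe f n := by
  refine ⟨C, ?_⟩
  filter_upwards [mem_nhdsWithin_of_mem_nhds (ball_mem_nhds (0 : ℂ) hr)] with t ht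
  exact h t ht

/-- A plain bound ‖f‖ ≤ M on a disc is order 0. [folklore] -/
theorem OrderGe.of_norm_le {f : ℂ → E} {M r : ℝ} (hr : 0 < r)
    (h : ∀ t ∈ ball (0 : ℂ) r, ‖f t‖ ≤ M) : OrderGe f 0 :=
  OrderGe.of_bound_on_ball hr (C := M) (fun t ht => by simpa using h t ht)

/-- Order ≥ 1 at 0 and continuity at 0 force f(0) = 0. [folklore] -/
theorem eq_zero_of_orderGe_succ {f : ℂ → E} {n : ℕ} (hc : ContinuousAt f 0) (h : OrderGe f (n + 1)) :
    f 0 = 0 := by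
  obtain ⟨C, hC⟩ := h
  have h1 : Tendsto (fun t => ‖f t‖) (𝓝[≠] (0 : ℂ)) (𝓝 ‖f 0‖) :=
    (hc.tendsto.mono_left nhdsWithin_le_nhds).norm
  have h2 : Tendsto (fun t : ℂ => C * ‖t‖ ^ (n + 1)) (𝓝[≠] (0 : ℂ)) (𝓝 0) := by
    have hcont : Continuous (fun t : ℂ => C * ‖t‖ ^ (n + 1)) := by fun_prop
    have := hcont.tendsto (0 : ℂ)
    rw [norm_zero, zero_pow (Nat.succ_ne_zero n), mul_zero] at this
    exact this.mono_left nhdsWithin_le_nhds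
  have h3 : ‖f 0‖ ≤ 0 := le_of_tendsto_of_tendsto h1 h2 hC
  exact norm_le_zero_iff.mp h3

section Slopes
variable [NormedSpace ℂ E]

/-- A factorisation f(t) = tⁿ·g(t) with g continuous at 0 (e.g. a convergent expansion in homogeneous terms of order
≥ n, as in (56) and [4] (136)) gives order n. [folklore] -/
theorem OrderGe.of_eq_pow_smul {f g : ℂ → E} {n : ℕ} (hg : ContinuousAt g 0)
    (hfg : ∀ t, f t = t ^ n • g t) : OrderGe f n := by
  refine ⟨‖g 0‖ + 1, ?_⟩
  have hbd : ∀ᶠ t in 𝓝 (0 : ℂ), g t ∈ ball (g 0) 1 := hg.eventually_mem (ball_mem_nhds _ one_pos)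
  filter_upwards [mem_nhdsWithin_of_mem_nhds hbd] with t ht
  have hgt : ‖g t‖ ≤ ‖g 0‖ + 1 := by
    have h1 : ‖g t - g 0‖ < 1 := by simpa [dist_eq_norm] using ht
    calc ‖g t‖ = ‖g 0 + (g t - g 0)‖ := by rw [add_sub_cancel]
      _ ≤ ‖g 0‖ + ‖g t - g 0‖ := norm_add_le _ _
      _ ≤ ‖g 0‖ + 1 := by linarith
  rw [hfg t, norm_smul, norm_pow, mul_comm]
  exact mul_le_mul_of_nonneg_right hgt (pow_nonneg (norm_nonneg t) n)

/-- The k-th iterated divided slope of f at 0 (Mathlib `dslope`, iterated as in `pow_sub_smul_iterate_dslope_of_zero`):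
`tail f 0 = f`, `tail f (k+1) = dslope (tail f k) 0`.  For f analytic with f = O(tⁿ): f(t) = tⁿ · tail f n t
(`eq_pow_smul_tail`). [folklore] -/
noncomputable def tail (f : ℂ → E) (k : ℕ) : ℂ → E :=
  (Function.swap dslope (0 : ℂ))^[k] f

/-- The leading (order-n) Taylor coefficient of f at 0: aₙ := tail f n 0 (= lim_{t → 0} t⁻ⁿ f(t), `tendsto_leadCoeff`).
In the readings: a₂ of t ↦ D(tÂ′; c) is D^{(2)}(Â′; c); a₁ of t ↦ 𝔇(tÂ; c, b) is the linear term of 𝔇. [folklore] -/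
noncomputable def leadCoeff (f : ℂ → E) (n : ℕ) : E :=
  tail f n 0

/-- `tail f 0 = f`. [folklore] -/
@[simp] theorem tail_zero (f : ℂ → E) : tail f 0 = f := rfl

/-- `tail f (k+1) = dslope (tail f k) 0` (outer step). [folklore] -/
theorem tail_succ (f : ℂ → E) (k : ℕ) : tail f (k + 1) = dslope (tail f k) 0 := by
  simp only [tail, Function.iterate_succ_apply']

/-- `tail f (k+1) = tail (dslope f 0) k` (inner step, the form the induction uses). [folklore] -/
theorem tail_succ' (f : ℂ → E) (k : ℕ) : tail f (k + 1) = tail (dslope f 0) k := by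
  simp only [tail, Function.iterate_succ_apply]

/-- `leadCoeff f 0 = f 0`. [folklore] -/
theorem leadCoeff_zero (f : ℂ → E) : leadCoeff f 0 = f 0 := rfl

/-- `leadCoeff f 1 = deriv f 0` (Mathlib `dslope_same`): the «linear term» of the p. 289 remark is f′(0). [folklore] -/
theorem leadCoeff_one (f : ℂ → E) : leadCoeff f 1 = deriv f 0 := by
  simp [leadCoeff, tail_succ, dslope_same]

section Analytic
variable [CompleteSpace E]

/-- Iterated divided slopes of an analytic function are analytic on the same disc (removable singularity,
`Complex.differentiableOn_dslope`). [folklore] -/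
theorem differentiableOn_tail {r : ℝ} (hr : 0 < r) {f : ℂ → E} (hd : DifferentiableOn ℂ f (ball 0 r)) (k : ℕ) :
    DifferentiableOn ℂ (tail f k) (ball 0 r) := by
  induction k with
  | zero => simpa using hd
  | succ k ih =>
    rw [tail_succ]
    exact (Complex.differentiableOn_dslope (ball_mem_nhds (0 : ℂ) hr)).mpr ih

/-- THE INDUCTION (order-n Schwarz lemma in coefficient form).  For f analytic on the disc |t| < r with ‖f‖ ≤ M there
and f = O(tⁿ) at 0: the first n divided slopes vanish at 0 and the n-th is bounded by M/rⁿ on the disc.  Step: f(0) = 0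
(`eq_zero_of_orderGe_succ`), g := dslope f 0 is analytic with ‖g‖ ≤ M/r (Mathlib's Schwarz lemma
`Complex.norm_dslope_le_div_of_mapsTo_ball`) and g = O(tⁿ⁻¹). [folklore] -/
theorem tail_vanish_and_bound {r : ℝ} (hr : 0 < r) :
    ∀ (n : ℕ) (M : ℝ) (f : ℂ → E), DifferentiableOn ℂ f (ball 0 r) → (∀ t ∈ ball (0 : ℂ) r, ‖f t‖ ≤ M) →
      OrderGe f n → (∀ k < n, tail f k 0 = 0) ∧ (∀ t ∈ ball (0 : ℂ) r, ‖tail f n t‖ ≤ M / r ^ n) := by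
  intro n
  induction n with
  | zero =>
    intro M f _ hM _
    exact ⟨fun k hk => absurd hk (Nat.not_lt_zero k), fun t ht => by simpa using hM t ht⟩
  | succ n ih =>
    intro M f hd hM hO
    have hcont : ContinuousAt f 0 := (hd.differentiableAt (ball_mem_nhds (0 : ℂ) hr)).continuousAt
    have hf0 : f 0 = 0 := eq_zero_of_orderGe_succ hcont hO
    have hgd : DifferentiableOn ℂ (dslope f 0) (ball 0 r) :=
      (Complex.differentiableOn_dslope (ball_mem_nhds (0 : ℂ) hr)).mpr hd
    have hgM : ∀ t ∈ ball (0 : ℂ) r, ‖dslope f 0 t‖ ≤ M / r := by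
      intro t ht
      have hmaps : MapsTo f (ball (0 : ℂ) r) (closedBall (f 0) M) := by
        intro s hs
        rw [mem_closedBall, dist_eq_norm, hf0, sub_zero]
        exact hM s hs
      exact Complex.norm_dslope_le_div_of_mapsTo_ball hd hmaps ht
    have hgO : OrderGe (dslope f 0) n := by
      obtain ⟨C, hC⟩ := hO
      refine ⟨C, ?_⟩
      filter_upwards [hC, self_mem_nhdsWithin] with t ht hne
      have hne' : t ≠ 0 := hne
      have htn : ‖t‖ ≠ 0 := norm_ne_zero_iff.mpr hne'
      have hgt : dslope f 0 t = t⁻¹ • f t := by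
        rw [dslope_of_ne _ hne', slope_def_module, sub_zero, hf0, sub_zero]
      rw [hgt, norm_smul, norm_inv]
      calc ‖t‖⁻¹ * ‖f t‖ ≤ ‖t‖⁻¹ * (C * ‖t‖ ^ (n + 1)) := by gcongr
        _ = C * ‖t‖ ^ n := by field_simp; ring
    obtain ⟨ih1, ih2⟩ := ih (M / r) (dslope f 0) hgd hgM hgO
    refine ⟨?_, ?_⟩
    · intro k hk
      cases k with
      | zero => simpa using hf0
      | succ k =>
        rw [tail_succ']
        exact ih1 k (Nat.lt_of_succ_lt_succ hk)
    · intro t ht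
      calc ‖tail f (n + 1) t‖ = ‖tail (dslope f 0) n t‖ := by rw [tail_succ']
        _ ≤ M / r / r ^ n := ih2 t ht
        _ = M / r ^ (n + 1) := by rw [div_div, ← pow_succ']

/-! ## §2  The order-n Schwarz lemma, the leading coefficient, the next remainder -/

/-- Factorisation f(t) = tⁿ · (tail f n)(t) for all t (Mathlib `pow_sub_smul_iterate_dslope_of_zero`, fed by the vanishing
of the first n divided slopes). [folklore] -/
theorem eq_pow_smul_tail {r M : ℝ} (hr : 0 < r) {n : ℕ} {f : ℂ → E} (hd : DifferentiableOn ℂ f (ball 0 r))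
    (hM : ∀ t ∈ ball (0 : ℂ) r, ‖f t‖ ≤ M) (hO : OrderGe f n) (t : ℂ) : f t = t ^ n • tail f n t := by
  have h := pow_sub_smul_iterate_dslope_of_zero n (tail_vanish_and_bound hr n M f hd hM hO).1 t
  simpa [tail] using h.symm

/-- ORDER-n SCHWARZ LEMMA (vector-valued): f analytic on |t| < r, ‖f‖ ≤ M there, f = O(tⁿ) at 0 ⟹ ‖f(t)‖ ≤ M(|t|/r)ⁿ.
(n = 1, f(0) = 0 is the classical Schwarz lemma; the cell's «maximum principle on f(t)/tⁿ».) [folklore] -/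
theorem norm_le_of_orderGe {r M : ℝ} {n : ℕ} {f : ℂ → E} (hd : DifferentiableOn ℂ f (ball 0 r))
    (hM : ∀ t ∈ ball (0 : ℂ) r, ‖f t‖ ≤ M) (hO : OrderGe f n) {t : ℂ} (ht : t ∈ ball (0 : ℂ) r) :
    ‖f t‖ ≤ M * (‖t‖ / r) ^ n := by
  have hr : 0 < r := lt_of_le_of_lt (norm_nonneg t) (mem_ball_zero_iff.mp ht)
  obtain ⟨_, hb⟩ := tail_vanish_and_bound hr n M f hd hM hO
  rw [eq_pow_smul_tail hr hd hM hO t, norm_smul, norm_pow]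
  calc ‖t‖ ^ n * ‖tail f n t‖ ≤ ‖t‖ ^ n * (M / r ^ n) := by gcongr; exact hb t ht
    _ = M * (‖t‖ / r) ^ n := by rw [div_pow]; ring

/-- CAUCHY-TYPE BOUND ON THE LEADING COEFFICIENT: ‖aₙ‖ ≤ M/rⁿ. [folklore] -/
theorem norm_leadCoeff_le {r M : ℝ} (hr : 0 < r) {n : ℕ} {f : ℂ → E} (hd : DifferentiableOn ℂ f (ball 0 r))
    (hM : ∀ t ∈ ball (0 : ℂ) r, ‖f t‖ ≤ M) (hO : OrderGe f n) : ‖leadCoeff f n‖ ≤ M / r ^ n :=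
  (tail_vanish_and_bound hr n M f hd hM hO).2 0 (mem_ball_self hr)

/-- INTRINSIC MEANING OF aₙ: t⁻ⁿ f(t) → aₙ as t → 0 (t ≠ 0); so aₙ does not depend on r, M or the construction, and for
a slice t ↦ F(tÂ) of an analytic functional whose expansion starts at order n it is the n-th homogeneous term at Â.
[folklore] -/
theorem tendsto_leadCoeff {r M : ℝ} (hr : 0 < r) {n : ℕ} {f : ℂ → E} (hd : DifferentiableOn ℂ f (ball 0 r))
    (hM : ∀ t ∈ ball (0 : ℂ) r, ‖f t‖ ≤ M) (hO : OrderGe f n) :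
    Tendsto (fun t : ℂ => (t ^ n)⁻¹ • f t) (𝓝[≠] (0 : ℂ)) (𝓝 (leadCoeff f n)) := by
  have hcont : ContinuousAt (tail f n) 0 :=
    ((differentiableOn_tail hr hd n).differentiableAt (ball_mem_nhds (0 : ℂ) hr)).continuousAt
  have h1 : Tendsto (tail f n) (𝓝[≠] (0 : ℂ)) (𝓝 (tail f n 0)) := hcont.tendsto.mono_left nhdsWithin_le_nhds
  refine h1.congr' ?_
  filter_upwards [self_mem_nhdsWithin] with t hne
  have hne' : t ≠ 0 := hne
  rw [eq_pow_smul_tail hr hd hM hO t, smul_smul, inv_mul_cancel₀ (pow_ne_zero n hne'), one_smul]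

/-- Uniqueness hook 1: any limit of t⁻ⁿ f(t) along t → 0, t ≠ 0, IS aₙ. [folklore] -/
theorem leadCoeff_eq_of_tendsto {r M : ℝ} (hr : 0 < r) {n : ℕ} {f : ℂ → E} (hd : DifferentiableOn ℂ f (ball 0 r))
    (hM : ∀ t ∈ ball (0 : ℂ) r, ‖f t‖ ≤ M) (hO : OrderGe f n) {a : E}
    (ha : Tendsto (fun t : ℂ => (t ^ n)⁻¹ • f t) (𝓝[≠] (0 : ℂ)) (𝓝 a)) : leadCoeff f n = a :=
  tendsto_nhds_unique (tendsto_leadCoeff hr hd hM hO) ha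

/-- Uniqueness hook 2 (the form (56)/(136) deliver): if f(t) − tⁿ·a = O(tⁿ⁺¹) at 0 for some vector a, then a = aₙ.
For the slice of D: «D − D^{(2)} consists of the homogeneous terms of order ≥ 3 of the convergent expansion (56)» ⟹
D^{(2)}(Â′; c) = `leadCoeff (t ↦ D(tÂ′; c)) 2`. [folklore] -/
theorem leadCoeff_eq_of_orderGe_sub {r M : ℝ} (hr : 0 < r) {n : ℕ} {f : ℂ → E}
    (hd : DifferentiableOn ℂ f (ball 0 r)) (hM : ∀ t ∈ ball (0 : ℂ) r, ‖f t‖ ≤ M) (hO : OrderGe f n) {a : E}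
    (hrem : OrderGe (fun t => f t - t ^ n • a) (n + 1)) : leadCoeff f n = a := by
  apply leadCoeff_eq_of_tendsto hr hd hM hO
  obtain ⟨C, hC⟩ := hrem
  rw [tendsto_iff_norm_sub_tendsto_zero]
  have hlim : Tendsto (fun t : ℂ => C * ‖t‖) (𝓝[≠] (0 : ℂ)) (𝓝 0) := by
    have hcont : Continuous (fun t : ℂ => C * ‖t‖) := by fun_prop
    have := hcont.tendsto (0 : ℂ)
    rw [norm_zero, mul_zero] at this
    exact this.mono_left nhdsWithin_le_nhds
  refine squeeze_zero' (Eventually.of_forall fun t => norm_nonneg _) ?_ hlim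
  filter_upwards [hC, self_mem_nhdsWithin] with t ht hne
  have hne' : t ≠ 0 := hne
  have htn : ‖t‖ ≠ 0 := norm_ne_zero_iff.mpr hne'
  have hrew : (t ^ n)⁻¹ • f t - a = (t ^ n)⁻¹ • (f t - t ^ n • a) := by
    rw [smul_sub, smul_smul, inv_mul_cancel₀ (pow_ne_zero n hne'), one_smul]
  rw [hrew, norm_smul, norm_inv, norm_pow]
  calc (‖t‖ ^ n)⁻¹ * ‖f t - t ^ n • a‖ ≤ (‖t‖ ^ n)⁻¹ * (C * ‖t‖ ^ (n + 1)) := by gcongr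
    _ = C * ‖t‖ := by field_simp; ring

/-- THE REMAINDER AFTER THE LEADING TERM: if moreover ‖aₙ‖ ≤ A, then ‖f(t) − tⁿaₙ‖ ≤ (M + A rⁿ)(|t|/r)ⁿ⁺¹ on the disc
(f − tⁿaₙ is analytic, bounded by M + A rⁿ, of order n + 1; apply `norm_le_of_orderGe`).  With A = M/rⁿ
(`norm_leadCoeff_le`) the constant is 2M. [folklore] -/
theorem norm_sub_leadCoeff_le {r M A : ℝ} {n : ℕ} {f : ℂ → E} (hd : DifferentiableOn ℂ f (ball 0 r))
    (hM : ∀ t ∈ ball (0 : ℂ) r, ‖f t‖ ≤ M) (hO : OrderGe f n) (hA : ‖leadCoeff f n‖ ≤ A)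
    {t : ℂ} (ht : t ∈ ball (0 : ℂ) r) :
    ‖f t - t ^ n • leadCoeff f n‖ ≤ (M + A * r ^ n) * (‖t‖ / r) ^ (n + 1) := by
  have hr : 0 < r := lt_of_le_of_lt (norm_nonneg t) (mem_ball_zero_iff.mp ht)
  have hA0 : 0 ≤ A := (norm_nonneg _).trans hA
  have hFd : DifferentiableOn ℂ (fun s => f s - s ^ n • leadCoeff f n) (ball 0 r) :=
    hd.sub ((differentiableOn_id.pow n).smul_const (leadCoeff f n))
  have hFM : ∀ s ∈ ball (0 : ℂ) r, ‖f s - s ^ n • leadCoeff f n‖ ≤ M + A * r ^ n := by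
    intro s hs
    have hs' : ‖s‖ < r := mem_ball_zero_iff.mp hs
    calc ‖f s - s ^ n • leadCoeff f n‖ ≤ ‖f s‖ + ‖s ^ n • leadCoeff f n‖ := norm_sub_le _ _
      _ ≤ M + A * r ^ n := by
        apply add_le_add (hM s hs)
        rw [norm_smul, norm_pow, mul_comm]
        exact mul_le_mul hA (pow_le_pow_left₀ (norm_nonneg s) hs'.le n) (pow_nonneg (norm_nonneg s) n) hA0
  have key : ∀ s, f s - s ^ n • leadCoeff f n = s ^ (n + 1) • tail f (n + 1) s := by
    intro s
    have h1 := eq_pow_smul_tail hr hd hM hO s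
    have h2 := sub_smul_dslope (tail f n) 0 s
    rw [sub_zero, ← tail_succ] at h2
    rw [h1, leadCoeff, ← smul_sub, ← h2, smul_smul, ← pow_succ]
  have hFO : OrderGe (fun s => f s - s ^ n • leadCoeff f n) (n + 1) := by
    have hcont : ContinuousAt (tail f (n + 1)) 0 :=
      ((differentiableOn_tail hr hd (n + 1)).differentiableAt (ball_mem_nhds (0 : ℂ) hr)).continuousAt
    exact OrderGe.of_eq_pow_smul hcont key
  exact norm_le_of_orderGe hFd hFM hFO ht

/-- The same with the intrinsic coefficient bound A = M/rⁿ: ‖f(t) − tⁿaₙ‖ ≤ 2M(|t|/r)ⁿ⁺¹. [folklore] -/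
theorem norm_sub_leadCoeff_le_two {r M : ℝ} {n : ℕ} {f : ℂ → E} (hd : DifferentiableOn ℂ f (ball 0 r))
    (hM : ∀ t ∈ ball (0 : ℂ) r, ‖f t‖ ≤ M) (hO : OrderGe f n) {t : ℂ} (ht : t ∈ ball (0 : ℂ) r) :
    ‖f t - t ^ n • leadCoeff f n‖ ≤ 2 * M * (‖t‖ / r) ^ (n + 1) := by
  have hr : 0 < r := lt_of_le_of_lt (norm_nonneg t) (mem_ball_zero_iff.mp ht)
  have h := norm_sub_leadCoeff_le hd hM hO (norm_leadCoeff_le hr hd hM hO) ht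
  have hMr : M + M / r ^ n * r ^ n = 2 * M := by
    rw [div_mul_cancel₀ M (pow_ne_zero n hr.ne')]; ring
  rwa [hMr] at h

/-! ## §3  The homogeneous-bound form: ‖f(t)‖ ≤ K|t|ⁿ on |t| < r (how (55), (135) and the family (73) read on a slice) -/

/-- From ‖f(t)‖ ≤ K|t|ⁿ on the disc (K ≥ 0): f = O(tⁿ), ‖f‖ ≤ K rⁿ, hence ‖aₙ‖ ≤ K. [folklore] -/
theorem norm_leadCoeff_le_of_pow_bound {r K : ℝ} (hr : 0 < r) (hK : 0 ≤ K) {n : ℕ} {f : ℂ → E}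
    (hd : DifferentiableOn ℂ f (ball 0 r)) (hKb : ∀ t ∈ ball (0 : ℂ) r, ‖f t‖ ≤ K * ‖t‖ ^ n) :
    ‖leadCoeff f n‖ ≤ K := by
  have hM : ∀ t ∈ ball (0 : ℂ) r, ‖f t‖ ≤ K * r ^ n := by
    intro t ht
    have ht' : ‖t‖ < r := mem_ball_zero_iff.mp ht
    exact (hKb t ht).trans (mul_le_mul_of_nonneg_left (pow_le_pow_left₀ (norm_nonneg t) ht'.le n) hK)
  have h := norm_leadCoeff_le hr hd hM (OrderGe.of_bound_on_ball hr hKb)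
  rwa [mul_div_assoc, div_self (pow_ne_zero n hr.ne'), mul_one] at h

/-- From ‖f(t)‖ ≤ K|t|ⁿ on |t| < r and ‖aₙ‖ ≤ A: ‖f(t) − tⁿaₙ‖ ≤ (K + A) r⁻¹ |t|ⁿ⁺¹ — the r⁻¹ is the whole point
(«Schwarz: c·r·(z/r)² = c·z²/r», cell GAPS G-adv9-52): the larger the disc on which the hypothesis is available, the
smaller the constant. [folklore] -/
theorem norm_sub_leadCoeff_le_of_pow_bound {r K A : ℝ} (hr : 0 < r) (hK : 0 ≤ K) {n : ℕ} {f : ℂ → E}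
    (hd : DifferentiableOn ℂ f (ball 0 r)) (hKb : ∀ t ∈ ball (0 : ℂ) r, ‖f t‖ ≤ K * ‖t‖ ^ n)
    (hA : ‖leadCoeff f n‖ ≤ A) {t : ℂ} (ht : t ∈ ball (0 : ℂ) r) :
    ‖f t - t ^ n • leadCoeff f n‖ ≤ (K + A) * r⁻¹ * ‖t‖ ^ (n + 1) := by
  have hM : ∀ t ∈ ball (0 : ℂ) r, ‖f t‖ ≤ K * r ^ n := by
    intro t ht
    have ht' : ‖t‖ < r := mem_ball_zero_iff.mp ht
    exact (hKb t ht).trans (mul_le_mul_of_nonneg_left (pow_le_pow_left₀ (norm_nonneg t) ht'.le n) hK)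
  have h := norm_sub_leadCoeff_le hd hM (OrderGe.of_bound_on_ball hr hKb) hA ht
  have heq : (K * r ^ n + A * r ^ n) * (‖t‖ / r) ^ (n + 1) = (K + A) * r⁻¹ * ‖t‖ ^ (n + 1) := by
    have hrn : r ^ n ≠ 0 := pow_ne_zero n hr.ne'
    calc (K * r ^ n + A * r ^ n) * (‖t‖ / r) ^ (n + 1)
        = (K + A) * ‖t‖ ^ (n + 1) * r⁻¹ * (r ^ n * (r ^ n)⁻¹) := by rw [div_pow, pow_succ r]; ring
      _ = (K + A) * r⁻¹ * ‖t‖ ^ (n + 1) := by rw [mul_inv_cancel₀ hrn]; ring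
  rwa [heq] at h

/-- The same with the intrinsic A = K: ‖f(t) − tⁿaₙ‖ ≤ 2K r⁻¹ |t|ⁿ⁺¹. [folklore] -/
theorem norm_sub_leadCoeff_le_of_pow_bound_two {r K : ℝ} (hr : 0 < r) (hK : 0 ≤ K) {n : ℕ} {f : ℂ → E}
    (hd : DifferentiableOn ℂ f (ball 0 r)) (hKb : ∀ t ∈ ball (0 : ℂ) r, ‖f t‖ ≤ K * ‖t‖ ^ n)
    {t : ℂ} (ht : t ∈ ball (0 : ℂ) r) :
    ‖f t - t ^ n • leadCoeff f n‖ ≤ 2 * K * r⁻¹ * ‖t‖ ^ (n + 1) := by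
  have h := norm_sub_leadCoeff_le_of_pow_bound hr hK hd hKb (norm_leadCoeff_le_of_pow_bound hr hK hd hKb) ht
  have heq : (K + K) * r⁻¹ * ‖t‖ ^ (n + 1) = 2 * K * r⁻¹ * ‖t‖ ^ (n + 1) := by ring
  rwa [heq] at h

/-! ## §4  The B11 readings with the printed constants -/

/-- (55) ⟹ «a power series expansion of D(A′) begins with second order terms» (p. 286), kernel-checked along a slice:
‖f(t)‖ ≤ 4C₂|t|² on |t| < ε₃ and analyticity give f(0) = 0 and f′(0) = 0.
[cite: Balaban1985Variational, (55) p.286] -/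
theorem reading_begins_at_two {C₂ ε₃ : ℝ} (hC₂ : 0 ≤ C₂) (hε : 0 < ε₃) {f : ℂ → E}
    (hd : DifferentiableOn ℂ f (ball 0 ε₃)) (h55 : ∀ t ∈ ball (0 : ℂ) ε₃, ‖f t‖ ≤ 4 * C₂ * ‖t‖ ^ 2) :
    f 0 = 0 ∧ deriv f 0 = 0 := by
  have hM : ∀ t ∈ ball (0 : ℂ) ε₃, ‖f t‖ ≤ 4 * C₂ * ε₃ ^ 2 := by
    intro t ht
    have ht' : ‖t‖ < ε₃ := mem_ball_zero_iff.mp ht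
    exact (h55 t ht).trans
      (mul_le_mul_of_nonneg_left (pow_le_pow_left₀ (norm_nonneg t) ht'.le 2) (by positivity))
  have h := (tail_vanish_and_bound hε 2 (4 * C₂ * ε₃ ^ 2) f hd hM (OrderGe.of_bound_on_ball hε h55)).1
  refine ⟨by simpa using h 0 (by norm_num), ?_⟩
  have h1 := h 1 (by norm_num)
  rwa [tail_succ, tail_zero, dslope_same] at h1

/-- READING (D₃), cell GAPS G-adv2-29 (ii).  Along the slice t ↦ f(t) = D(tÂ′; c), |Â′|_{(−1)} = 1, analytic for
|t| < ε₃ (p. 286: D is *"an analytic function of A′"* on L^jη|A′| < ε₃) with (55) ‖f(t)‖ ≤ 4C₂|t|²: the second-order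
coefficient a₂ (= D^{(2)}(Â′; c), hooks `tendsto_leadCoeff` / `leadCoeff_eq_of_orderGe_sub`) has ‖a₂‖ ≤ 4C₂, and the
order-≥-3 remainder D₃(tÂ′; c) = f(t) − t²a₂ obeys ‖f(t) − t²a₂‖ ≤ 8C₂ε₃⁻¹|t|³ for |t| < ε₃ — the cubic bound on D₃
with G-adv2-29's constant 8C₂ε₃⁻¹ (ε₃⁻¹ ≥ 18C₂B₀ by p. 286).  Printed nowhere on pp. 286–290.
[cite: Balaban1985Variational, (55)-(56) p.286; (78), (80) p.290] -/
theorem reading_D3 {C₂ ε₃ : ℝ} (hC₂ : 0 ≤ C₂) (hε : 0 < ε₃) {f : ℂ → E}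
    (hd : DifferentiableOn ℂ f (ball 0 ε₃)) (h55 : ∀ t ∈ ball (0 : ℂ) ε₃, ‖f t‖ ≤ 4 * C₂ * ‖t‖ ^ 2)
    {t : ℂ} (ht : t ∈ ball (0 : ℂ) ε₃) :
    ‖leadCoeff f 2‖ ≤ 4 * C₂ ∧ ‖f t - t ^ 2 • leadCoeff f 2‖ ≤ 8 * C₂ * ε₃⁻¹ * ‖t‖ ^ 3 := by
  have hK : 0 ≤ 4 * C₂ := by positivity
  refine ⟨norm_leadCoeff_le_of_pow_bound hε hK hd h55, ?_⟩
  have h := norm_sub_leadCoeff_le_of_pow_bound_two hε hK hd h55 ht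
  have heq : 2 * (4 * C₂) * ε₃⁻¹ * ‖t‖ ^ (2 + 1) = 8 * C₂ * ε₃⁻¹ * ‖t‖ ^ 3 := by ring
  rwa [heq] at h

/-- READING (D₃) with [4] (135) fed in: if in addition ‖a₂‖ ≤ C₂ (the bound |C^{(2)}(X)| ≤ C₂|X|² on the quadratic
form of C_j, itself `reading_C2_of_135`, transported by D^{(2)}(A′) = C_j^{(2)}(L^jηA′), p. 286, and |L^jηÂ′| ≤ 1),
then ‖f(t) − t²a₂‖ ≤ 5C₂ε₃⁻¹|t|³.
[cite: Balaban1985Variational, (55)-(56) p.286] [cite: Balaban1985Averaging, Prop. 4 (135) p.38] -/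
theorem reading_D3_with135 {C₂ ε₃ : ℝ} (hC₂ : 0 ≤ C₂) (hε : 0 < ε₃) {f : ℂ → E}
    (hd : DifferentiableOn ℂ f (ball 0 ε₃)) (h55 : ∀ t ∈ ball (0 : ℂ) ε₃, ‖f t‖ ≤ 4 * C₂ * ‖t‖ ^ 2)
    (h135 : ‖leadCoeff f 2‖ ≤ C₂) {t : ℂ} (ht : t ∈ ball (0 : ℂ) ε₃) :
    ‖f t - t ^ 2 • leadCoeff f 2‖ ≤ 5 * C₂ * ε₃⁻¹ * ‖t‖ ^ 3 := by
  have hK : 0 ≤ 4 * C₂ := by positivity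
  have h := norm_sub_leadCoeff_le_of_pow_bound hε hK hd h55 h135 ht
  have heq : (4 * C₂ + C₂) * ε₃⁻¹ * ‖t‖ ^ (2 + 1) = 5 * C₂ * ε₃⁻¹ * ‖t‖ ^ 3 := by ring
  rwa [heq] at h

/-- READING of [4] (135) as a bound on the quadratic form: along a slice s ↦ g(s) = C_k(U₀, sX̂; c), |X̂| = 1, analytic
for |s| < c₄ with ‖g(s)‖ ≤ C₂|s|², the s²-coefficient — C_k^{(2)}(U₀, X̂; c) of (136) — has norm ≤ C₂; by
2-homogeneity |C^{(2)}(X)| ≤ C₂|X|².  [cite: Balaban1985Averaging, Prop. 4 (134)-(136) pp.38-39] -/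
theorem reading_C2_of_135 {C₂ c₄ : ℝ} (hC₂ : 0 ≤ C₂) (hc₄ : 0 < c₄) {g : ℂ → E}
    (hg : DifferentiableOn ℂ g (ball 0 c₄)) (h135 : ∀ s ∈ ball (0 : ℂ) c₄, ‖g s‖ ≤ C₂ * ‖s‖ ^ 2) :
    ‖leadCoeff g 2‖ ≤ C₂ :=
  norm_leadCoeff_le_of_pow_bound hc₄ hC₂ hg h135

/-- READING (D₃) at the real parameter t = ρ = |A′|_{(−1)} ∈ [0, ε₃): with f the slice through Â′ = A′/ρ,
D₃(A′; c) = f(ρ) − ρ²a₂ and ‖D₃(A′; c)‖ ≤ 8C₂ε₃⁻¹ρ³ = 8C₂ε₃⁻¹|A′|³_{(−1)} — the sup-norm statement is this, component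
by component. [cite: Balaban1985Variational, (55)-(56) p.286; (78), (80) p.290] -/
theorem reading_D3_real {C₂ ε₃ ρ : ℝ} (hC₂ : 0 ≤ C₂) (hε : 0 < ε₃) (hρ0 : 0 ≤ ρ) (hρ : ρ < ε₃) {f : ℂ → E}
    (hd : DifferentiableOn ℂ f (ball 0 ε₃)) (h55 : ∀ t ∈ ball (0 : ℂ) ε₃, ‖f t‖ ≤ 4 * C₂ * ‖t‖ ^ 2) :
    ‖f ρ - (ρ : ℂ) ^ 2 • leadCoeff f 2‖ ≤ 8 * C₂ * ε₃⁻¹ * ρ ^ 3 := by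
  have hmem : (ρ : ℂ) ∈ ball (0 : ℂ) ε₃ := by
    rw [mem_ball_zero_iff, Complex.norm_real, Real.norm_eq_abs, abs_of_nonneg hρ0]
    exact hρ
  have h := (reading_D3 hC₂ hε hd h55 hmem).2
  rwa [Complex.norm_real, Real.norm_eq_abs, abs_of_nonneg hρ0] at h

/-- READING (𝔇₂), cell GAPS G-adv9-52.  Along the slice t ↦ f(t) = 𝔇(tÂ; c, b), |Â|_{(−1)} = 1, analytic for |t| < a
(a = a₃ := min{(18C₂B₀dc₁(½))⁻¹, ½c₄}, the threshold of Proposition 3, on whose chart (73) is proved for every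
ε₃ ≤ a₃), the family of bounds (73)_{ε₃ ≤ a₃} reads ‖f(t)‖ ≤ K|t| with K = O(1)C₃(L^jη)^{−d+1}e^{−(1/2)δ₀d(c₋,y)}.
Then the linear coefficient a₁ (the term the remark subtracts) has ‖a₁‖ ≤ K, and 𝔇₂(tÂ; c, b) = f(t) − t a₁ obeys
‖f(t) − t a₁‖ ≤ 2K a⁻¹|t|² ≤ 2K a⁻¹ε₃² for |t| < ε₃ ≤ a: «the bound (73) with ε₃² instead of ε₃» holds with O(1)
replaced by 2·O(1)/a₃ — a (d, L)-constant — and NOT with a radius-free constant (`tightness_witness`).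
[cite: Balaban1985Variational, (73) + Prop. 3 + remark p.289] -/
theorem reading_frakD2 {K a ε₃ : ℝ} (hK : 0 ≤ K) (ha : 0 < a) (hεa : ε₃ ≤ a) {f : ℂ → E}
    (hd : DifferentiableOn ℂ f (ball 0 a)) (h73 : ∀ t ∈ ball (0 : ℂ) a, ‖f t‖ ≤ K * ‖t‖ ^ 1)
    {t : ℂ} (ht : ‖t‖ < ε₃) :
    ‖leadCoeff f 1‖ ≤ K ∧ ‖f t - t ^ 1 • leadCoeff f 1‖ ≤ 2 * K * a⁻¹ * ‖t‖ ^ 2 ∧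
      ‖f t - t ^ 1 • leadCoeff f 1‖ ≤ 2 * K * a⁻¹ * ε₃ ^ 2 := by
  have hta : t ∈ ball (0 : ℂ) a := mem_ball_zero_iff.mpr (lt_of_lt_of_le ht hεa)
  have h2 := norm_sub_leadCoeff_le_of_pow_bound_two ha hK hd h73 hta
  refine ⟨norm_leadCoeff_le_of_pow_bound ha hK hd h73, h2, h2.trans ?_⟩
  have : ‖t‖ ^ 2 ≤ ε₃ ^ 2 := pow_le_pow_left₀ (norm_nonneg t) ht.le 2
  have hc : 0 ≤ 2 * K * a⁻¹ := by positivity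
  exact mul_le_mul_of_nonneg_left this hc

/-- TIGHTNESS (cell GAPS G-adv9-52, engine line «Schwarz: c·r·(z/r)² = c·z²/r» as a theorem).  For every K ≥ 0 and
radius a > 0 the function f(t) = (K/a)t² is analytic, satisfies the slice form of (73) ‖f(t)‖ ≤ K|t| on |t| < a, has
linear coefficient a₁ = 0, and its remainder is EXACTLY ‖f(t) − t a₁‖ = K a⁻¹|t|²: the factor a⁻¹ in `reading_frakD2`
cannot be removed, and at a = ε₃, |t| → ε₃ the remainder is Kε₃ — the size of (73) itself, no ε₃². [folklore] -/
theorem tightness_witness {K a : ℝ} (hK : 0 ≤ K) (ha : 0 < a) :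
    let f : ℂ → ℂ := fun t => ((K / a : ℝ) : ℂ) * t ^ 2
    DifferentiableOn ℂ f (ball 0 a) ∧ (∀ t ∈ ball (0 : ℂ) a, ‖f t‖ ≤ K * ‖t‖ ^ 1) ∧ leadCoeff f 1 = 0 ∧
      ∀ t : ℂ, ‖f t - t ^ 1 • leadCoeff f 1‖ = K * a⁻¹ * ‖t‖ ^ 2 := by
  intro f
  have hKa : 0 ≤ K / a := div_nonneg hK ha.le
  have hdiff : Differentiable ℂ f := by
    show Differentiable ℂ (fun t : ℂ => ((K / a : ℝ) : ℂ) * t ^ 2)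
    fun_prop
  have hderiv : deriv f 0 = 0 := by
    show deriv (fun t : ℂ => ((K / a : ℝ) : ℂ) * t ^ 2) 0 = 0
    rw [deriv_const_mul _ (differentiableAt_pow 2), deriv_pow_field]
    simp
  have hlc : leadCoeff f 1 = 0 := by rw [leadCoeff_one, hderiv]
  have hnorm : ∀ t : ℂ, ‖f t‖ = K / a * ‖t‖ ^ 2 := by
    intro t
    show ‖((K / a : ℝ) : ℂ) * t ^ 2‖ = K / a * ‖t‖ ^ 2
    rw [norm_mul, Complex.norm_real, Real.norm_eq_abs, abs_of_nonneg hKa, norm_pow]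
  refine ⟨hdiff.differentiableOn, ?_, hlc, ?_⟩
  · intro t ht
    have ht' : ‖t‖ < a := mem_ball_zero_iff.mp ht
    rw [hnorm t, pow_one]
    calc K / a * ‖t‖ ^ 2 = (K * ‖t‖) * (‖t‖ / a) := by ring
      _ ≤ (K * ‖t‖) * 1 := by
          apply mul_le_mul_of_nonneg_left _ (mul_nonneg hK (norm_nonneg t))
          rw [div_le_one ha]
          exact ht'.le
      _ = K * ‖t‖ := mul_one _
  · intro t
    rw [hlc, smul_zero, sub_zero, hnorm t, div_eq_mul_inv]

end Analytic

end Slopes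

end Literature.MathematicalPhysics.QuantumFieldTheory.Balaban1983to89.B11SchwarzRemainder
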